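import Mathlib
import Summits.Ventures.PercRepro2.Defs
import Summits.Ventures.PercRepro2.Graph
import Summits.Ventures.PercRepro2.OneColourSwitch
import Summits.Ventures.PercRepro2.OneColourSwitchFibre
import Summits.Ventures.PercRepro2.M9PendantFibreSign
import Summits.Ventures.PercRepro2.CutVertexHarrisFibre
import Summits.Ventures.PercRepro2.RegionHubSign

/-!
# The exploration-pattern sign inequality with a decreasing attachment factor
(blind cell PercRepro2, p3 g17, 2026-08-27; `proofs/P3-CPNC.md` §14e, second inequality)

`RegionHubSign.sum_sigma_nonpos_of_explMeasurable` says: for an event `A` determined by the edges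
touching the `Y`-exploration `expl H ω` of a hub set `H` and forcing `r ∉ expl H ω`,
`Σ_ω 1_A(ω) σ_rs(ω) ≤ 0`.  Here the same holds with an extra DECREASING factor: for every upper set
`U` of configurations, `Σ_ω 1_A(ω) · 1[compl ω ∈ U] · σ_rs(ω) ≤ 0` (`sum_sigma_nonpos_of_explMeasurable_attach`).
The attachment event of §14e — «every hub of `H₀` is `W`-connected to `r` or to `s`» — is
`compl ω ∈ U` for the upper set `U = {every h ∈ H₀ is Y-connected to r or s}` (`sum_sigma_nonpos_of_pattern_attach`).

**Proof.**  Group the configurations by the REPRESENTATIVE `rep H ω` (the edges not touching the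
explored set set to `false`): the class of `z` is the fibre `fibre F z` of `OneColourSwitchFibre`
with `F = free H z` the edges not touching `expl H z`, and `A` is constant on it.  On the fibre a
`Y`-path from `r` never meets the explored set, so `r ~_Y s` is `r ~ s` in `pin0 F ω` (the pinned
edges set to `false`; `conn_iff_conn_pin0`), an upper set in `ω`; and `compl ω = flipOn F (ψ ω)` with
`ψ = flipOn Fᶜ` the pinned flip, a bijection from the fibre of `z` onto the fibre of `ψ z` that does
not change `pin0`.  On the fibre of `ψ z` the left count is `#{pin0 ω ∈ conn, flipOn F ω ∈ U}`, which
the cell's Harris-with-the-complement on a fibre (`CutVertexM9.card_filter_le_of_isUpperSet_fibre`)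
bounds by `#{ω ∈ U, pin0 ω ∈ conn} ≤ #{ω ∈ U ∩ conn}` (`pin0 F ω ≤ ω`), and the fibre flip turns the
last count into the right count `#{flipOn F ω ∈ U ∩ conn}`.  Own work; std axioms.
-/

namespace Summit.Ventures.PercRepro2

namespace RegionHub

open Finset Classical OneColourSwitch

variable {V : Type*} {E : Type*}
variable (ends : E → Sym2 V)

/-- The free edges of the explored set of `z`: those not touching it. -/
def free (H : Set V) (z : Config E) : Set E := {e | e ∉ touches ends (expl ends H z)}

/-- The representative of a configuration: the free edges set to `false`. -/
noncomputable def rep (H : Set V) (ω : Config E) : Config E :=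
  fun e => if e ∈ touches ends (expl ends H ω) then ω e else false

variable {ends}

/-- `rep` agrees with `ω` on the edges touching the explored set. -/
lemma rep_of_mem {H : Set V} {ω : Config E} {e : E} (h : e ∈ touches ends (expl ends H ω)) :
    rep ends H ω e = ω e := by simp [rep, h]

/-- `rep` explores the same set. -/
lemma expl_rep (H : Set V) (ω : Config E) : expl ends H (rep ends H ω) = expl ends H ω :=
  expl_eq_of_eqOn_touches fun _ he => (rep_of_mem he).symm

/-- Every configuration lies in the fibre of its representative. -/
lemma mem_fibre_rep (H : Set V) (ω : Config E) :
    ω ∈ fibre (free ends H (rep ends H ω)) (rep ends H ω) := by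
  intro e he
  simp only [free, Set.mem_setOf_eq, not_not, expl_rep] at he
  exact (rep_of_mem he).symm

/-- Two configurations with the same representative explore the same set. -/
lemma expl_eq_of_rep_eq {H : Set V} {ω ω' : Config E} (h : rep ends H ω = rep ends H ω') :
    expl ends H ω' = expl ends H ω := by
  rw [← expl_rep H ω', ← h, expl_rep]

/-- The representatives of the members of a fibre of a representative `z` are `z` itself. -/
lemma rep_eq_of_mem_fibre {H : Set V} {z ω : Config E} (hz : rep ends H z = z)
    (hω : ω ∈ fibre (free ends H z) z) : rep ends H ω = z := by
  have hexpl : expl ends H ω = expl ends H z := by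
    apply expl_eq_of_eqOn_touches
    intro e he
    have : e ∉ free ends H z := by simpa [free] using he
    exact (hω e this).symm
  funext e
  by_cases he : e ∈ touches ends (expl ends H z)
  · have he' : e ∈ touches ends (expl ends H ω) := by rwa [hexpl]
    have hfree : e ∉ free ends H z := by simpa [free] using he
    rw [rep_of_mem he', hω e hfree]
  · have he' : e ∉ touches ends (expl ends H ω) := by rwa [hexpl]
    have h1 : rep ends H ω e = false := by simp [rep, he']
    have h2 : z e = false := by rw [← hz]; simp [rep, he]
    rw [h1, h2]

/-- The fibre of a representative is exactly its class. -/
lemma mem_fibre_iff_rep_eq {H : Set V} {z ω : Config E} (hz : rep ends H z = z) :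
    ω ∈ fibre (free ends H z) z ↔ rep ends H ω = z := by
  constructor
  · exact rep_eq_of_mem_fibre hz
  · intro h
    have := mem_fibre_rep (ends := ends) H ω
    rwa [h] at this

/-- `rep` is idempotent. -/
lemma rep_rep (H : Set V) (ω : Config E) : rep ends H (rep ends H ω) = rep ends H ω := by
  funext e
  by_cases he : e ∈ touches ends (expl ends H ω)
  · have he' : e ∈ touches ends (expl ends H (rep ends H ω)) := by rwa [expl_rep]
    rw [rep_of_mem he']
  · have he' : e ∉ touches ends (expl ends H (rep ends H ω)) := by rwa [expl_rep]
    simp [rep, he, he']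

/-! ## Transport of the events along the pinned flip -/

/-- `compl ω = flipOn F (flipOn Fᶜ ω)`. -/
lemma compl_eq_flipOn_flipOn_compl (F : Set E) (ω : Config E) :
    OneColourSwitch.compl ω = flipOn F (flipOn Fᶜ ω) := by
  funext e
  by_cases h : e ∈ F
  · have h' : e ∉ Fᶜ := by simpa using h
    simp [OneColourSwitch.compl, flipOn, h, h']
  · have h' : e ∈ Fᶜ := by simpa using h
    simp [OneColourSwitch.compl, flipOn, h, h']

/-- The pinned flip carries the fibre of `z` onto the fibre of `flipOn Fᶜ z`. -/
lemma flipOn_compl_mem_fibre {F : Set E} {z ω : Config E} :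
    flipOn Fᶜ ω ∈ fibre F (flipOn Fᶜ z) ↔ ω ∈ fibre F z := by
  constructor
  · intro h e he
    have := h e he
    have he' : e ∈ Fᶜ := by simpa using he
    simp only [flipOn, he', if_true] at this
    exact Bool.not_inj this
  · intro h e he
    have := h e he
    have he' : e ∈ Fᶜ := by simpa using he
    simp [flipOn, he', this]

/-- The pinned flip is an involution. -/
lemma flipOn_compl_flipOn_compl (F : Set E) (ω : Config E) : flipOn Fᶜ (flipOn Fᶜ ω) = ω :=
  flipOn_flipOn ω

/-- The pinned edges set to `false`. -/
noncomputable def pin0 (F : Set E) (ω : Config E) : Config E := fun e => if e ∈ F then ω e else false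

/-- `pin0 F ω ≤ ω`. -/
lemma pin0_le (F : Set E) (ω : Config E) : pin0 F ω ≤ ω := by
  intro e
  by_cases h : e ∈ F <;> simp [pin0, h]

/-- `pin0` only looks at the free edges. -/
lemma pin0_flipOn_compl (F : Set E) (ω : Config E) : pin0 F (flipOn Fᶜ ω) = pin0 F ω := by
  funext e
  by_cases h : e ∈ F
  · have h' : e ∉ Fᶜ := by simpa using h
    simp [pin0, flipOn, h, h']
  · simp [pin0, h]

/-- `{ω : r ~ s in pin0 F ω}` is an upper set. -/
lemma isUpperSet_conn_pin0 (F : Set E) (r s : V) :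
    IsUpperSet {ω : Config E | Conn ends (pin0 F ω) r s} := by
  intro ω ω' hle h
  refine conn_mono ?_ h
  intro e
  by_cases he : e ∈ F
  · simp only [pin0, he, if_true]; exact hle e
  · simp [pin0, he]

/-- On the fibre of a representative `z` (`r` outside the explored set), `r ~_Y s` only uses the
free edges: `Conn ω r s ↔ Conn (pin0 F ω) r s`. -/
lemma conn_iff_conn_pin0 {H : Set V} {z ω : Config E} {r s : V}
    (hz : rep ends H z = z) (hω : ω ∈ fibre (free ends H z) z) (hr : r ∉ expl ends H z) :
    Conn ends ω r s ↔ Conn ends (pin0 (free ends H z) ω) r s := by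
  have h1 : rep ends H ω = rep ends H z := by rw [rep_eq_of_mem_fibre hz hω, hz]
  have hexpl : expl ends H ω = expl ends H z := (expl_eq_of_rep_eq h1).symm
  have hr' : r ∉ expl ends H ω := by rwa [hexpl]
  constructor
  · intro h
    refine conn_of_eqOn_notTouches hr' ?_ h
    intro e he
    have : e ∈ free ends H z := by
      rw [hexpl] at he
      simpa [free] using he
    simp [pin0, this]
  · intro h
    exact conn_mono (pin0_le _ _) h

section Count

variable [Fintype E] [DecidableEq E]

/-- The fibre inequality with the attachment factor: on the fibre of a representative `z`, for an
upper set `U`, `#{compl ω ∈ U, r ~_Y s} ≤ #{compl ω ∈ U, r ~_W s}`. -/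
lemma card_fibre_attach_le {H : Set V} {z : Config E} (hz : rep ends H z = z) {r s : V}
    (hr : r ∉ expl ends H z) {U : Set (Config E)} (hU : IsUpperSet U) :
    (univ.filter (fun ω : Config E => ω ∈ fibre (free ends H z) z ∧
        OneColourSwitch.compl ω ∈ U ∧ Conn ends ω r s)).card ≤
      (univ.filter (fun ω : Config E => ω ∈ fibre (free ends H z) z ∧
        OneColourSwitch.compl ω ∈ U ∧ Conn ends (OneColourSwitch.compl ω) r s)).card := by
  set F := free ends H z with hF
  set z' := flipOn Fᶜ z with hz'
  -- transport both sides to the fibre of `z'` by the pinned flip `ψ = flipOn Fᶜ`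
  have htrans : ∀ (P : Config E → Prop) [DecidablePred P],
      (univ.filter (fun ω : Config E => ω ∈ fibre F z ∧ P ω)).card =
        (univ.filter (fun ω : Config E => ω ∈ fibre F z' ∧ P (flipOn Fᶜ ω))).card := by
    intro P _
    refine Finset.card_bij (fun ω _ => flipOn Fᶜ ω) ?_ ?_ ?_
    · intro ω hω
      simp only [mem_filter, mem_univ, true_and] at hω ⊢
      refine ⟨?_, ?_⟩
      · rw [hz']; exact flipOn_compl_mem_fibre.2 hω.1
      · rw [flipOn_compl_flipOn_compl]; exact hω.2
    · intro ω₁ _ ω₂ _ h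
      have := congrArg (flipOn Fᶜ) h
      rwa [flipOn_compl_flipOn_compl, flipOn_compl_flipOn_compl] at this
    · intro ω hω
      refine ⟨flipOn Fᶜ ω, ?_, flipOn_compl_flipOn_compl F ω⟩
      simp only [mem_filter, mem_univ, true_and] at hω ⊢
      refine ⟨?_, ?_⟩
      · have := hω.1
        rw [hz'] at this
        exact flipOn_compl_mem_fibre.1 (by rwa [flipOn_compl_flipOn_compl])
      · exact hω.2
  rw [htrans, htrans]
  -- the left side: `{flipOn F ω ∈ U, pin0 ω ∈ conn}`; the right side: `{flipOn F ω ∈ U ∩ conn}`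
  have hL : ∀ ω ∈ fibre F z',
      (OneColourSwitch.compl (flipOn Fᶜ ω) ∈ U ∧ Conn ends (flipOn Fᶜ ω) r s) ↔
        (ω ∈ {ω : Config E | Conn ends (pin0 F ω) r s} ∧ flipOn F ω ∈ U) := by
    intro ω hω
    have hω' : flipOn Fᶜ ω ∈ fibre F z := by
      have := (flipOn_compl_mem_fibre (F := F) (z := z) (ω := flipOn Fᶜ ω)).1
      rw [flipOn_compl_flipOn_compl] at this
      exact this (by rwa [hz'] at hω)
    rw [compl_eq_flipOn_flipOn_compl F, flipOn_compl_flipOn_compl,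
      conn_iff_conn_pin0 hz hω' hr, pin0_flipOn_compl]
    simp only [Set.mem_setOf_eq]
    exact and_comm
  have hR : ∀ ω : Config E,
      (OneColourSwitch.compl (flipOn Fᶜ ω) ∈ U ∧
          Conn ends (OneColourSwitch.compl (flipOn Fᶜ ω)) r s) ↔
        (flipOn F ω ∈ U ∩ connEvent ends r s) := by
    intro ω
    rw [compl_eq_flipOn_flipOn_compl F, flipOn_compl_flipOn_compl]
    simp only [Set.mem_inter_iff, connEvent, Set.mem_setOf_eq]
  have hLc : (univ.filter (fun ω : Config E => ω ∈ fibre F z' ∧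
        (OneColourSwitch.compl (flipOn Fᶜ ω) ∈ U ∧ Conn ends (flipOn Fᶜ ω) r s))).card =
      (univ.filter (fun ω : Config E => ω ∈ fibre F z' ∧
        (ω ∈ {ω : Config E | Conn ends (pin0 F ω) r s} ∧ flipOn F ω ∈ U))).card := by
    congr 1
    refine Finset.filter_congr (fun ω _ => ?_)
    constructor
    · rintro ⟨h1, h2⟩; exact ⟨h1, (hL ω h1).1 h2⟩
    · rintro ⟨h1, h2⟩; exact ⟨h1, (hL ω h1).2 h2⟩
  have hRc : (univ.filter (fun ω : Config E => ω ∈ fibre F z' ∧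
        (OneColourSwitch.compl (flipOn Fᶜ ω) ∈ U ∧
          Conn ends (OneColourSwitch.compl (flipOn Fᶜ ω)) r s))).card =
      (univ.filter (fun ω : Config E => ω ∈ fibre F z' ∧
        ω ∈ U ∩ connEvent ends r s)).card := by
    rw [show (univ.filter (fun ω : Config E => ω ∈ fibre F z' ∧
        (OneColourSwitch.compl (flipOn Fᶜ ω) ∈ U ∧
          Conn ends (OneColourSwitch.compl (flipOn Fᶜ ω)) r s))) =
        univ.filter (fun ω : Config E => ω ∈ fibre F z' ∧ flipOn F ω ∈ U ∩ connEvent ends r s) from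
        Finset.filter_congr (fun ω _ => by
          constructor
          · rintro ⟨h1, h2⟩; exact ⟨h1, (hR ω).1 h2⟩
          · rintro ⟨h1, h2⟩; exact ⟨h1, (hR ω).2 h2⟩)]
    -- the fibre flip
    refine Finset.card_bij (fun ω _ => flipOn F ω) ?_ ?_ ?_
    · intro ω hω
      simp only [mem_filter, mem_univ, true_and] at hω ⊢
      exact ⟨flipOn_mem_fibre.2 hω.1, hω.2⟩
    · intro ω₁ _ ω₂ _ h
      have := congrArg (flipOn F) h
      rwa [flipOn_flipOn, flipOn_flipOn] at this
    · intro ω hω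
      refine ⟨flipOn F ω, ?_, flipOn_flipOn ω⟩
      simp only [mem_filter, mem_univ, true_and] at hω ⊢
      refine ⟨flipOn_mem_fibre.2 hω.1, ?_⟩
      rw [flipOn_flipOn]; exact hω.2
  rw [hLc, hRc]
  -- Harris with the complement on the fibre, then monotonicity `pin0 ω ≤ ω`
  calc (univ.filter (fun ω : Config E => ω ∈ fibre F z' ∧
        (ω ∈ {ω : Config E | Conn ends (pin0 F ω) r s} ∧ flipOn F ω ∈ U))).card
      ≤ (univ.filter (fun ω : Config E => ω ∈ fibre F z' ∧
          ω ∈ U ∩ {ω : Config E | Conn ends (pin0 F ω) r s})).card :=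
        CutVertexM9.card_filter_le_of_isUpperSet_fibre F z' hU (isUpperSet_conn_pin0 F r s)
          _ _ (fun ω => Iff.rfl) (fun ω => Iff.rfl)
    _ ≤ (univ.filter (fun ω : Config E => ω ∈ fibre F z' ∧ ω ∈ U ∩ connEvent ends r s)).card := by
        apply Finset.card_le_card
        intro ω hω
        simp only [mem_filter, mem_univ, true_and, Set.mem_inter_iff, Set.mem_setOf_eq,
          connEvent] at hω ⊢
        exact ⟨hω.1, hω.2.1, conn_mono (pin0_le F ω) hω.2.2⟩

/-- **The exploration-pattern sign inequality with a decreasing factor.**  For `A` determined by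
the edges touching the explored set of `H` and forcing `r` outside it, and any upper set `U`,
`Σ_ω 1_A(ω) · 1[compl ω ∈ U] · σ_rs(ω) ≤ 0`. -/
theorem sum_sigma_nonpos_of_explMeasurable_attach (H : Set V) (A : Config E → Prop) (r s : V)
    (hA : ∀ ω ω' : Config E, (∀ e ∈ touches ends (expl ends H ω), ω e = ω' e) → A ω → A ω')
    (hAr : ∀ ω, A ω → r ∉ expl ends H ω) {U : Set (Config E)} (hU : IsUpperSet U) :
    ∑ ω : Config E, (if A ω ∧ OneColourSwitch.compl ω ∈ U then OneColourSwitch.sigma ends ω r s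
      else 0) ≤ 0 := by
  -- group by the representative
  rw [← Finset.sum_fiberwise (s := univ) (g := rep ends H)]
  refine Finset.sum_nonpos (fun z _ => ?_)
  by_cases hz : rep ends H z = z
  · -- the class of a representative is its fibre, on which `A` is constant
    have hclass : (univ.filter (fun ω : Config E => rep ends H ω = z)) =
        univ.filter (fun ω : Config E => ω ∈ fibre (free ends H z) z) :=
      Finset.filter_congr (fun ω _ => (mem_fibre_iff_rep_eq hz).symm)
    rw [hclass]
    by_cases hAz : A z
    · have hr : r ∉ expl ends H z := hAr z hAz
      have hAω : ∀ ω ∈ fibre (free ends H z) z, A ω := by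
        intro ω hω
        refine hA z ω ?_ hAz
        intro e he
        have : e ∉ free ends H z := by simpa [free] using he
        exact (hω e this).symm
      -- split the sign into the two counts
      have hsplit : ∀ ω ∈ fibre (free ends H z) z,
          (if A ω ∧ OneColourSwitch.compl ω ∈ U then OneColourSwitch.sigma ends ω r s else 0) =
            (if ω ∈ fibre (free ends H z) z ∧ OneColourSwitch.compl ω ∈ U ∧ Conn ends ω r s
              then (1 : ℤ) else 0) -
            (if ω ∈ fibre (free ends H z) z ∧ OneColourSwitch.compl ω ∈ U ∧
              Conn ends (OneColourSwitch.compl ω) r s then (1 : ℤ) else 0) := by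
        intro ω hω
        have := hAω ω hω
        unfold OneColourSwitch.sigma
        by_cases h1 : OneColourSwitch.compl ω ∈ U <;> by_cases h2 : Conn ends ω r s <;>
          by_cases h3 : Conn ends (OneColourSwitch.compl ω) r s <;> simp [this, hω, h1, h2, h3]
      rw [Finset.sum_congr rfl (fun ω hω => hsplit ω (Finset.mem_filter.1 hω).2),
        Finset.sum_sub_distrib, sub_nonpos]
      have hcnt : ∀ (P : Config E → Prop) [DecidablePred P],
          (∑ ω ∈ univ.filter (fun ω : Config E => ω ∈ fibre (free ends H z) z),
            (if ω ∈ fibre (free ends H z) z ∧ P ω then (1 : ℤ) else 0)) =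
            ((univ.filter (fun ω : Config E => ω ∈ fibre (free ends H z) z ∧ P ω)).card : ℤ) := by
        intro P _
        rw [Finset.sum_boole, Finset.filter_filter]
        congr 2
        exact Finset.filter_congr (fun ω _ => by tauto)
      rw [hcnt (fun ω => OneColourSwitch.compl ω ∈ U ∧ Conn ends ω r s),
        hcnt (fun ω => OneColourSwitch.compl ω ∈ U ∧ Conn ends (OneColourSwitch.compl ω) r s)]
      exact_mod_cast card_fibre_attach_le hz hr hU
    · -- `A` fails on the whole class: every term is `0`
      refine le_of_eq (Finset.sum_eq_zero (fun ω hω => ?_))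
      have hω := (Finset.mem_filter.1 hω).2
      have h1 : rep ends H ω = rep ends H z := by rw [rep_eq_of_mem_fibre hz hω, hz]
      have hexpl : expl ends H ω = expl ends H z := (expl_eq_of_rep_eq h1).symm
      have : ¬ A ω := fun hAω => hAz (hA ω z (fun e he => by
        have hfree : e ∉ free ends H z := by
          rw [hexpl] at he
          simpa [free] using he
        exact hω e hfree) hAω)
      simp [this]
  · -- `z` is not a representative: its class is empty
    have : univ.filter (fun ω : Config E => rep ends H ω = z) = ∅ := by
      apply Finset.filter_eq_empty_iff.2
      intro ω _ h
      apply hz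
      rw [← h, rep_rep]
    rw [this, Finset.sum_empty]

/-- The attachment version for the hub pattern: «every hub of `H₀` is `W`-connected to `r` or `s`»
is `compl ω ∈ U` for the upper set `U` below. -/
theorem sum_sigma_nonpos_of_pattern_attach (H : Set V) (P : Set (V × V)) (r s : V)
    (hP : ∀ xy ∈ P, xy.1 ∈ H) :
    ∑ ω : Config E,
      (if pattern ends H P r s ω ∧
          (∀ h ∈ H, Conn ends (OneColourSwitch.compl ω) h r ∨
            Conn ends (OneColourSwitch.compl ω) h s)
        then OneColourSwitch.sigma ends ω r s else 0) ≤ 0 := by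
  have hU : IsUpperSet {ω : Config E | ∀ h ∈ H, Conn ends ω h r ∨ Conn ends ω h s} := by
    intro ω ω' hle hω h hh
    rcases hω h hh with h1 | h1
    · exact Or.inl (conn_mono hle h1)
    · exact Or.inr (conn_mono hle h1)
  have := sum_sigma_nonpos_of_explMeasurable_attach H (pattern ends H P r s) r s
    (fun _ _ h hω => pattern_of_eqOn hP h hω) (fun _ hω => not_mem_expl_of_pattern hω) hU
  exact this

end Count

end RegionHub

end Summit.Ventures.PercRepro2
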